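import Summits.QuantumFields.BalabanUV.Beta.SymSliceProjectorKernel
import Summits.QuantumFields.BalabanUV.Beta.KernelOrthoProjectorReindex

/-!
# `BalabanUV.Beta.SymSliceProjectorPerm` — binder row D1, JSB12SYM-SPINE v1.2 D-K4-3 (brick K1b-5, permutation half): `permK (axisPerm σ) (symEc N) = symEc N`
# — THE SYMMETRISED SLICE PROJECTOR IS PERMUTATION-INVARIANT AT THE CENTRED ROOT (the `hP`-letter of the slice itself)

`Gmat` is invariant under the simultaneous relabelling of block sites and interior bonds by `σ` (S1 `symTreeGaugeAt_ctr_P1`, the centred root is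
`σ`-fixed), hence so is `Pmat = kerProj Gmat` (`kerProj_submatrix`), hence so is `symEc` (with `IsIntBond`, `blk`, `off`, `Torus.proj` transported).
HONEST FRAMING (cell contract, verbatim): «discharging `BetaPertH` makes Bałaban's UV stability UNCONDITIONAL — a real constructive-QFT
result; it is NOT the continuum limit and NOT the Clay problem.»  [folklore] bookkeeping of OUR objects; discharges NOTHING of row D1; JsB12Sym 0∕4.
0 sorry, 0 `def … : Prop`, nothing cited.  NOT HERE: the reflection half (`refK`, `N` odd).  NOT D1, NOT BetaPertH, NOT continuum, NOT Clay.
HONEST DEPENDENCY (verbatim): «continuum YM on T⁴ ⇐ BetaPertH ∧ nine spine estimates (0/9 proved); BetaPertH ⇐ (D1) ∧ (D4) ∧ CAP+tail;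
G-an2-4 gates asym, D1 and NE2/3/4.»  Unit `b2b-balaban-beta-an2` gen 25 (row-D1 owner), 2026-08-21.
-/

namespace Summit.QuantumFields.BalabanUV.Beta.SymSliceProjectorPerm

noncomputable section

open Finset Matrix
open scoped BigOperators Nat
open Literature.MathematicalPhysics.QuantumFieldTheory
open Literature.MathematicalPhysics.QuantumFieldTheory.Balaban1983to89
open Literature.MathematicalPhysics.QuantumFieldTheory.Balaban1983to89.Beta
open Literature.Probability.LatticeModels (Torus.proj)
open ExpKernelCalculus (MKer)
open AffineAveraging (Form0 Form1 Site box toSite)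
open AveragingContours (blk off)
open AveragingContoursRooted (ctr ctrOff ctrOff_mem_box)
open OneStepResolventKernel (Fib)
open Summit.QuantumFields.BalabanUV.Beta.KernelPermutation (psite psite_apply permK permK_apply axisPerm axisPerm_r axisPerm_π_inl axisPerm_π_inr
  psite_inv_psite psite_psite_inv)
open Summit.QuantumFields.BalabanUV.Beta.ResolventPermutation (P1 P1_apply psite_mem_box toSite_psite proj_psite_eq_zero_iff)
open Summit.QuantumFields.BalabanUV.Beta.SymmetrisedAxialPotential
open Summit.QuantumFields.BalabanUV.Beta.SymmetrisedDressingMatrix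
open Summit.QuantumFields.BalabanUV.Beta.KernelOrthoProjector
open Summit.QuantumFields.BalabanUV.Beta.KernelOrthoProjectorReindex
open Summit.QuantumFields.BalabanUV.Beta.SymSliceBlockMatrix
open Summit.QuantumFields.BalabanUV.Beta.SymSliceProjectorKernel

variable {n : ℕ}

/-! ## §1 The relabelling equivalences of the index types -/

/-- [folklore] `off` commutes with the coordinate permutation. -/
theorem off_psite (σ : Equiv.Perm (Fin n)) (N : ℕ) (x : Site n) : off N (psite σ x) = psite σ (off N x) := rfl

/-- [folklore] The centred root offset is `σ`-fixed. -/
theorem psite_ctrOff (σ : Equiv.Perm (Fin n)) (N : ℕ) : psite σ (ctrOff n N) = ctrOff n N := rfl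

/-- [folklore] Interior-bond membership is permutation-invariant. -/
theorem mem_bIdxSet_perm_iff (σ : Equiv.Perm (Fin n)) {N : ℕ} (j : Fin n × (Fin n → ℕ)) :
    (σ j.1, psite σ j.2) ∈ bIdxSet n N ↔ j ∈ bIdxSet n N := by
  rw [mem_bIdxSet, mem_bIdxSet]
  simp only [psite_apply, Equiv.symm_apply_apply]
  constructor
  · rintro ⟨hb, hlt⟩
    refine ⟨?_, hlt⟩
    have := psite_mem_box σ⁻¹ hb
    rwa [psite_inv_psite] at this
  · rintro ⟨hb, hlt⟩
    exact ⟨psite_mem_box σ hb, hlt⟩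

/-- [folklore] Non-root membership is permutation-invariant. -/
theorem mem_cIdxSet_perm_iff (σ : Equiv.Perm (Fin n)) {N : ℕ} (c : Fin n → ℕ) : psite σ c ∈ cIdxSet n N ↔ c ∈ cIdxSet n N := by
  unfold cIdxSet
  rw [Finset.mem_erase, Finset.mem_erase]
  constructor
  · rintro ⟨hne, hb⟩
    refine ⟨fun h => hne (by rw [h]; rfl), ?_⟩
    have := psite_mem_box σ⁻¹ hb
    rwa [psite_inv_psite] at this
  · rintro ⟨hne, hb⟩
    refine ⟨fun h => hne ?_, psite_mem_box σ hb⟩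
    have := congrArg (psite σ⁻¹) h
    rw [psite_inv_psite] at this
    rw [this]; rfl

/-- [our object] The relabelling of interior bonds `(α, c) ↦ (σ α, σ•c)`. -/
def bPerm (σ : Equiv.Perm (Fin n)) (N : ℕ) : BIdx n N ≃ BIdx n N where
  toFun j := ⟨(σ j.1.1, psite σ j.1.2), (mem_bIdxSet_perm_iff σ j.1).2 j.2⟩
  invFun j := ⟨(σ⁻¹ j.1.1, psite σ⁻¹ j.1.2), (mem_bIdxSet_perm_iff σ⁻¹ j.1).2 j.2⟩
  left_inv j := by
    apply Subtype.ext
    refine Prod.ext ?_ ?_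
    · show σ⁻¹ (σ j.1.1) = j.1.1
      rw [Equiv.Perm.inv_def, Equiv.symm_apply_apply]
    · show psite σ⁻¹ (psite σ j.1.2) = j.1.2
      exact psite_inv_psite σ _
  right_inv j := by
    apply Subtype.ext
    refine Prod.ext ?_ ?_
    · show σ (σ⁻¹ j.1.1) = j.1.1
      rw [Equiv.Perm.inv_def, Equiv.apply_symm_apply]
    · show psite σ (psite σ⁻¹ j.1.2) = j.1.2
      exact psite_psite_inv σ _

/-- [our object] The relabelling of non-root block sites `c ↦ σ•c`. -/
def cPerm (σ : Equiv.Perm (Fin n)) (N : ℕ) : CIdx n N ≃ CIdx n N where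
  toFun z := ⟨psite σ z.1, (mem_cIdxSet_perm_iff σ z.1).2 z.2⟩
  invFun z := ⟨psite σ⁻¹ z.1, (mem_cIdxSet_perm_iff σ⁻¹ z.1).2 z.2⟩
  left_inv z := by apply Subtype.ext; simp only [psite_inv_psite]
  right_inv z := by apply Subtype.ext; simp only [psite_psite_inv]

/-! ## §2 `Gmat` and `Pmat` are invariant -/

/-- [folklore] **`Gmat` IS INVARIANT UNDER THE SIMULTANEOUS RELABELLING** (centred root `σ`-fixed; S1 `symTreeGaugeAt_ctr_P1`). -/
theorem Gmat_submatrix_perm (σ : Equiv.Perm (Fin n)) (N : ℕ) : (Gmat (n := n) N).submatrix (cPerm σ N) (bPerm σ N) = Gmat N := by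
  ext z j
  simp only [Matrix.submatrix_apply, Gmat, cPerm, bPerm, Equiv.coe_fn_mk, toSite_psite]
  have hb : bondIndR (σ j.1.1) (psite σ (toSite j.1.2)) = P1 σ⁻¹ (bondIndR j.1.1 (toSite j.1.2)) := by
    rw [P1_bondIndR]; rfl
  rw [hb, symTreeGaugeAt_ctr_P1, psite_inv_psite]

/-- [folklore] **`Pmat` IS INVARIANT**: `Pmat N (σ•i) (σ•j) = Pmat N i j`. -/
theorem Pmat_perm (σ : Equiv.Perm (Fin n)) (N : ℕ) (i j : BIdx n N) : Pmat N (bPerm σ N i) (bPerm σ N j) = Pmat N i j := by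
  have h := kerProj_submatrix (Gmat (n := n) N) (cPerm σ N) (bPerm σ N)
  rw [Gmat_submatrix_perm] at h
  have hij := congrFun (congrFun h i) j
  rw [Matrix.submatrix_apply] at hij
  rw [Pmat]
  exact hij.symm

/-! ## §3 `symEc` is permutation-invariant -/

section Kernel

variable {d : ℕ}

/-- [folklore] Interior-bond-ness is permutation-invariant. -/
theorem isIntBond_perm_iff (σ : Equiv.Perm (Fin (d + 1))) (N : ℕ) (α : Fin (d + 1)) (x : Fin (d + 1) → ℤ) :
    IsIntBond N (σ α) (psite σ x) ↔ IsIntBond N α x := by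
  unfold IsIntBond
  rw [off_psite]
  exact mem_bIdxSet_perm_iff σ (α, off N x)

/-- [folklore] **`symEc` IS PERMUTATION-INVARIANT AT THE CENTRED ROOT**: `permK (axisPerm σ) (symEc N) = symEc N` for every `σ ∈ S_{d+1}`. -/
theorem permK_symEc (σ : Equiv.Perm (Fin (d + 1))) (N : ℕ) : permK (axisPerm σ) (symEc (d := d) N) = symEc N := by
  funext x x' a b
  rw [permK_apply, axisPerm_r, axisPerm_r]
  rcases a with α | m <;> rcases b with β | m'
  · rw [axisPerm_π_inl, axisPerm_π_inl]
    by_cases h : IsIntBond N α x ∧ IsIntBond N β x'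
    · have h' : IsIntBond N (σ α) (psite σ x) ∧ IsIntBond N (σ β) (psite σ x') :=
        ⟨(isIntBond_perm_iff σ N α x).2 h.1, (isIntBond_perm_iff σ N β x').2 h.2⟩
      rw [symEc_inl_inl_of_int h'.1 h'.2, symEc_inl_inl_of_int h.1 h.2]
      simp only [blk_psite, (psite σ).injective.eq_iff]
      by_cases hb : blk N x = blk N x'
      · rw [if_pos hb, if_pos hb]
        have e := Pmat_perm σ N ⟨(α, off N x), h.1⟩ ⟨(β, off N x'), h.2⟩
        refine Eq.trans ?_ e
        congr 1
      · rw [if_neg hb, if_neg hb]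
    · have h' : ¬ (IsIntBond N (σ α) (psite σ x) ∧ IsIntBond N (σ β) (psite σ x')) := fun hh =>
        h ⟨(isIntBond_perm_iff σ N α x).1 hh.1, (isIntBond_perm_iff σ N β x').1 hh.2⟩
      rw [symEc_inl_inl_of_not_int h', symEc_inl_inl_of_not_int h]
      simp only [(psite σ).injective.eq_iff, σ.injective.eq_iff]
  · rw [axisPerm_π_inl, axisPerm_π_inr, symEc_inl_inr, symEc_inl_inr]
  · rw [axisPerm_π_inr, axisPerm_π_inl, symEc_inr_inl, symEc_inr_inl]
  · rw [axisPerm_π_inr, axisPerm_π_inr, symEc_inr_inr, symEc_inr_inr]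
    simp only [(psite σ).injective.eq_iff, σ.injective.eq_iff, proj_psite_eq_zero_iff]

end Kernel

end

end Summit.QuantumFields.BalabanUV.Beta.SymSliceProjectorPerm
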